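/-
COR-CM (cell pub-hodgecm2, stage 2 of the Hodge ladder) — count-neutral KERNEL COMBINATORICS «the binary tetrahedral group SL(2,3)», part XII: the DICTIONARY,
base changes and places (seat prover-pub-hodgecm2-b23-g53-0, binder prover b23, gen 53; claim HOME/INBOX.md l.24246, NAME ASK l.24300).  Bookkeeping
definitions with bodies (`ty`, `typeSetOf`, `typeOf`, `typeEquiv`) + theorems — gen 45ʼs `Census/OcticProduct{Dictionary,BaseChange,Places}.lean` for the words
`cᵉ aˢ x_k` of part XI; no `decide` beyond closed identities in `ZMod 2`/`Fin 4`, no certificate, no named fact, no `sorry`.  `Interfaces.lean` (C1), every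
E term, B01, `Transposition/*`, `PortJoin/*`, `D2Bridge/*` untouched.
HONEST FRAMING: `HC_CM` is NOT proved, here or anywhere in the tree; nothing here is a period, a count of record or a headline.
T5: n/a-class (hypothesis binders = the fields of `BinaryTetrahedral.Datum`); checker: self.
-/
import Summits.HodgeConjecture.CorCM.Census.BinaryTetrahedralWords

/-!
# The binary tetrahedral group, XII: abstract CM types of `(G, c)` along a binary tetrahedral datum ≃ labels of the model

Along a binary tetrahedral datum `D : Datum G c` the abstract CM types `CMF G c` are the labels `Ty₄ (ℤ/3)` of part IV: coordinate `k` of `ty Ψ` at the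
slot `s` is the exponent `e` with `word k (e, s) = cᵉ aˢ x_k ∈ Ψ` (§1, `word_mem_iff`; **`typeEquiv : CMF G c ≃ Ty₄ (ℤ/3)`**).  §2 **Base changes are the
motions**: `ty (Ψ·i⁻¹) = twZ 1 (ty Ψ)`, `ty (Ψ·(ij)⁻¹) = twT (ty Ψ)`, `ty (Ψ·a⁻¹) = twA 1 (ty Ψ)` (the sheared translation of part IV), `ty (Ψ·c) = conj₄ (ty Ψ)`
(and the `typeOf` forms).  §3 **Places**: flipping a type at the place of `word k (0, s)` flips the label at `(k, s)` (`typeOf_flipAt`).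
All [folklore] (Pohlmannʼs dictionary [Pohlmann1968, Thm 1] on the cosets of `⟨c, a⟩`).

## References
* [Pohlmann1968] H. Pohlmann, Algebraic cycles on abelian varieties of complex multiplication type, Ann. of Math. 88 (1968), Thm 1.
-/

namespace Summit.HodgeConjecture.CorCM.Census.BinaryTetrahedral

open Finset
open Summit.HodgeConjecture.CorCM.Prior.AllgGroup.RfwfAllgGroup
open Summit.HodgeConjecture.CorCM.Census.BlockParity
open Summit.HodgeConjecture.CorCM.Census.OddSliceFacesModel
open Summit.HodgeConjecture.CorCM.Census.QuarticInversion
open Summit.HodgeConjecture.CorCM.Census.OcticProduct (twZ coord_twZ)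

noncomputable section

variable {G : Type*} [Group G] [Fintype G] [DecidableEq G] {c : G} (D : Datum G c)

/-! ## §1 The dictionary -/

/-- **The label of an abstract CM type**: coordinate `k` at slot `s` is `0` if `word k (0, s) ∈ Ψ`, else `1`. [folklore] -/
def ty (Ψ : CMF G c) : Ty₄ (ZMod 3) :=
  ((fun s => if word D 0 (0, s) ∈ Ψ.1 then 0 else 1, fun s => if word D 1 (0, s) ∈ Ψ.1 then 0 else 1),
   (fun s => if word D 2 (0, s) ∈ Ψ.1 then 0 else 1, fun s => if word D 3 (0, s) ∈ Ψ.1 then 0 else 1))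

/-- The coordinates of the label of a type. [folklore] -/
theorem coord_ty (Ψ : CMF G c) (k : Fin 4) : coord (ZMod 3) k (ty D Ψ) = fun s => if word D k (0, s) ∈ Ψ.1 then 0 else 1 := by
  fin_cases k <;> rfl

/-- `ℤ/2` has two elements. [folklore] -/
private theorem zmod2_cases : ∀ e : ZMod 2, e = 0 ∨ e = 1 := by decide

/-- **`word k (e, s) ∈ Ψ ↔ coord k (ty Ψ) s = e`.** [folklore] -/
theorem word_mem_iff (Ψ : CMF G c) (k : Fin 4) (e : ZMod 2) (s : ZMod 3) : word D k (e, s) ∈ Ψ.1 ↔ coord (ZMod 3) k (ty D Ψ) s = e := by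
  rw [coord_ty]
  have hcm : word D k (1, s) ∈ Ψ.1 ↔ word D k (0, s) ∉ Ψ.1 := by
    have h := Ψ.2 (word D k (0, s))
    rw [c_mul_word, zero_add] at h
    tauto
  rcases zmod2_cases e with rfl | rfl
  · by_cases h : word D k (0, s) ∈ Ψ.1 <;> simp [h]
  · rw [hcm]; by_cases h : word D k (0, s) ∈ Ψ.1 <;> simp [h]

/-- The underlying set of the abstract CM type of a label: `word k (e, s)` belongs iff coordinate `k` at `s` is `e`. [folklore] -/
def typeSetOf (Θ : Ty₄ (ZMod 3)) : Finset G :=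
  univ.filter fun g => coord (ZMod 3) ((wordEquiv D).symm g).1 Θ ((wordEquiv D).symm g).2.2 = ((wordEquiv D).symm g).2.1

omit [DecidableEq G] in
/-- Membership of a word in the set of a label. [folklore] -/
theorem word_mem_typeSetOf (Θ : Ty₄ (ZMod 3)) (k : Fin 4) (e : ZMod 2) (s : ZMod 3) :
    word D k (e, s) ∈ typeSetOf D Θ ↔ coord (ZMod 3) k Θ s = e := by
  simp only [typeSetOf, mem_filter, mem_univ, true_and, wordEquiv_symm_word]

/-- The CM-type axiom in `ℤ/2`: `u = e ↔ ¬ u = e + 1`. [folklore] -/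
private theorem eq_iff_not_eq_add_one : ∀ u e : ZMod 2, u = e ↔ ¬ u = e + 1 := by decide

omit [DecidableEq G] in
/-- The set of a label is an abstract CM type. [folklore] -/
theorem isCMF_typeSetOf (Θ : Ty₄ (ZMod 3)) : IsCMF c (typeSetOf D Θ) := by
  intro g
  obtain ⟨k, ⟨e, s⟩, rfl⟩ := exists_word D g
  rw [c_mul_word, word_mem_typeSetOf, word_mem_typeSetOf]
  exact eq_iff_not_eq_add_one _ _

/-- **The abstract CM type of a label.** [folklore] -/
def typeOf (Θ : Ty₄ (ZMod 3)) : CMF G c := ⟨typeSetOf D Θ, isCMF_typeSetOf D Θ⟩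

/-- Two elements of `ℤ/2` that vanish together are equal. [folklore] -/
private theorem zmod2_eq_of_iff : ∀ {u v : ZMod 2}, (u = 0 ↔ v = 0) → u = v := by decide

/-- `ty ∘ typeOf = id`. [folklore] -/
theorem ty_typeOf (Θ : Ty₄ (ZMod 3)) : ty D (typeOf D Θ) = Θ := by
  refine ext_coord (ZMod 3) fun k => funext fun s => zmod2_eq_of_iff ?_
  rw [← word_mem_iff]
  exact word_mem_typeSetOf D Θ k 0 s

/-- `typeOf ∘ ty = id`. [folklore] -/
theorem typeOf_ty (Ψ : CMF G c) : typeOf D (ty D Ψ) = Ψ := by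
  apply Subtype.ext
  ext g
  obtain ⟨k, ⟨e, s⟩, rfl⟩ := exists_word D g
  exact (word_mem_typeSetOf D _ k e s).trans (word_mem_iff D Ψ k e s).symm

/-- **THE DICTIONARY**: abstract CM types of `(G, c)` ≃ labels of the model. [folklore] -/
def typeEquiv : CMF G c ≃ Ty₄ (ZMod 3) where
  toFun := ty D
  invFun := typeOf D
  left_inv := typeOf_ty D
  right_inv := ty_typeOf D

/-- `typeEquiv Ψ = ty Ψ`. [folklore] -/
@[simp] theorem typeEquiv_apply (Ψ : CMF G c) : typeEquiv D Ψ = ty D Ψ := rfl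

/-- `typeEquiv⁻¹ Θ = typeOf Θ`. [folklore] -/
@[simp] theorem typeEquiv_symm_apply (Θ : Ty₄ (ZMod 3)) : (typeEquiv D).symm Θ = typeOf D Θ := rfl

/-- `ty` is injective. [folklore] -/
theorem ty_injective : Function.Injective (ty (c := c) D) := (typeEquiv D).injective

/-! ## §2 Base changes are the motions -/

/-- The indicator of an equation in `ℤ/2`: `[x = m] = x + m` (as `0`/`1`). [folklore] -/
private theorem ite_eq_add : ∀ x m : ZMod 2, (if x = m then (0 : ZMod 2) else 1) = x + m := by decide

/-- The coordinates of the label of a base change: read the moved word. [folklore] -/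
theorem coord_ty_rt (Q : G) (Ψ : CMF G c) (k : Fin 4) (s : ZMod 3) :
    coord (ZMod 3) k (ty D (rt c Q Ψ)) s = if word D k (0, s) * Q ∈ Ψ.1 then 0 else 1 := by
  rw [coord_ty]
  simp only [mem_rt]

/-- **Base change along `i` is gen 45ʼs `twZ 1`.** [folklore] -/
theorem ty_rt_i (Ψ : CMF G c) : ty D (rt c D.i Ψ) = twZ (ZMod 3) 1 (ty D Ψ) := by
  refine ext_coord (ZMod 3) fun k => funext fun s => ?_
  rw [coord_ty_rt, word_mul_i]
  simp only [word_mem_iff, zero_add, ite_eq_add, coord_twZ, Pi.add_apply]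
  fin_cases k <;> simp [σY, bY]

/-- **Base change along `ij` is gen 44ʼs `twT`.** [folklore] -/
theorem ty_rt_k (Ψ : CMF G c) : ty D (rt c (D.i * D.j) Ψ) = twT (ZMod 3) (ty D Ψ) := by
  refine ext_coord (ZMod 3) fun k => funext fun s => ?_
  rw [coord_ty_rt, word_mul_k]
  simp only [word_mem_iff, zero_add, ite_eq_add, coord_twT, Pi.add_apply]
  fin_cases k <;> simp [σT, bT]

/-- **Base change along `a` is the sheared translation `twA 1`.** [folklore] -/
theorem ty_rt_a (Ψ : CMF G c) : ty D (rt c D.a Ψ) = twA (ZMod 3) 1 (ty D Ψ) := by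
  refine ext_coord (ZMod 3) fun k => funext fun s => ?_
  rw [coord_ty_rt, word_mul_a]
  simp only [word_mem_iff, ite_eq_add, coord_twA, tw, add_zero]

/-- **Base change along `c` is the conjugation `twH₄ (1, 0)`.** [folklore] -/
theorem ty_rt_c (Ψ : CMF G c) : ty D (rt c c Ψ) = twH₄ (ZMod 3) (1, 0) (ty D Ψ) := by
  refine ext_coord (ZMod 3) fun k => funext fun s => ?_
  rw [coord_ty_rt, word_mul_c]
  simp only [word_mem_iff, zero_add, ite_eq_add, coord_twH₄, tw, add_zero]

/-- `typeOf (twZ 1 Θ) = (typeOf Θ)·i⁻¹`. [folklore] -/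
theorem typeOf_twZ (Θ : Ty₄ (ZMod 3)) : typeOf D (twZ (ZMod 3) 1 Θ) = rt c D.i (typeOf D Θ) := by
  apply ty_injective D; rw [ty_rt_i, ty_typeOf, ty_typeOf]

/-- `typeOf (twT Θ) = (typeOf Θ)·(ij)⁻¹`. [folklore] -/
theorem typeOf_twT (Θ : Ty₄ (ZMod 3)) : typeOf D (twT (ZMod 3) Θ) = rt c (D.i * D.j) (typeOf D Θ) := by
  apply ty_injective D; rw [ty_rt_k, ty_typeOf, ty_typeOf]

/-- `typeOf (twA 1 Θ) = (typeOf Θ)·a⁻¹`. [folklore] -/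
theorem typeOf_twA (Θ : Ty₄ (ZMod 3)) : typeOf D (twA (ZMod 3) 1 Θ) = rt c D.a (typeOf D Θ) := by
  apply ty_injective D; rw [ty_rt_a, ty_typeOf, ty_typeOf]

/-- `typeOf (twH₄ (1,0) Θ) = (typeOf Θ)·c`. [folklore] -/
theorem typeOf_twH₄_one (Θ : Ty₄ (ZMod 3)) : typeOf D (twH₄ (ZMod 3) (1, 0) Θ) = rt c c (typeOf D Θ) := by
  apply ty_injective D; rw [ty_rt_c, ty_typeOf, ty_typeOf]

/-- `typeOf (conj₄ Θ) = (typeOf Θ)·c`. [folklore] -/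
theorem typeOf_conj₄ (Θ : Ty₄ (ZMod 3)) : typeOf D (conj₄ (ZMod 3) Θ) = rt c c (typeOf D Θ) := by
  rw [conj₄_eq_twH₄, typeOf_twH₄_one]

/-! ## §3 Places -/

/-- **Flipping at the place of `word k (0, s)` flips the label at `(k, s)`.** [folklore] -/
theorem ty_oflipCM_word (k : Fin 4) (s : ZMod 3) (Φ : CMF G c) :
    ty D (oflipCM c D.c_mul_c (word D k (0, s)) Φ) = flipAt (ZMod 3) (k, s) (ty D Φ) := by
  refine ext_coord (ZMod 3) fun k' => funext fun s' => ?_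
  rw [coord_flipAt, Pi.add_apply, coord_ty, coord_ty]
  simp only
  have hmem : word D k' (0, s') ∈ (oflipCM c D.c_mul_c (word D k (0, s)) Φ).1 ↔
      (word D k' (0, s') ∈ Φ.1 ↔ ¬ (k' = k ∧ s' = s)) := by
    show word D k' (0, s') ∈ oflip c (word D k (0, s)) Φ.1 ↔ _
    rw [oflip, Finset.mem_symmDiff, word_mem_orb_word_iff]
    tauto
  by_cases hk : k' = k ∧ s' = s
  · obtain ⟨rfl, rfl⟩ := hk
    rw [bump, if_pos rfl]
    simp only [hmem, and_self, not_true_eq_false, iff_false, δ, Pi.single_eq_same]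
    by_cases h : word D k' (0, s') ∈ Φ.1
    · simp only [h, not_true_eq_false, if_false, if_true, zero_add]
    · simp only [h, not_false_eq_true, if_true, if_false]; decide
  · have hb : bump (ZMod 3) k' ((k, s) : Pl (ZMod 3)) s' = 0 := by
      unfold bump
      by_cases hkk : k' = k
      · subst hkk
        have hs : s' ≠ s := fun h => hk ⟨rfl, h⟩
        rw [if_pos rfl, δ, Pi.single_apply, if_neg hs]
      · rw [if_neg hkk, Pi.zero_apply]
    rw [hb, add_zero]
    simp only [hmem, hk, not_false_eq_true, iff_true]

/-- The `typeOf` form: `typeOf (flipAt p Θ) = (typeOf Θ)^{(word p)}`. [folklore] -/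
theorem typeOf_flipAt (p : Pl (ZMod 3)) (Θ : Ty₄ (ZMod 3)) :
    typeOf D (flipAt (ZMod 3) p Θ) = oflipCM c D.c_mul_c (word D p.1 (0, p.2)) (typeOf D Θ) := by
  apply ty_injective D
  obtain ⟨k, s⟩ := p
  rw [ty_oflipCM_word, ty_typeOf, ty_typeOf]

end

end Summit.HodgeConjecture.CorCM.Census.BinaryTetrahedral
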